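import Literature.MathematicalPhysics.QuantumLattice.TorusWilsonGibbs
import Summits.QuantumFields.YangMills.Theses.ParabolicTrajectory
import Literature.Probability.LatticeModels.GibbsSpecification
import Literature.MathematicalPhysics.QuantumFieldTheory.YangMillsOS
import Mathlib.Probability.Moments.Covariance
import Summits.QuantumFields.YangMills.Theorems.ParabolicTrajectoryLatticeGapOnTrajectoryDefs

/-!
# Route `ParabolicTrajectory`, crux `LatticeGapOnTrajectory` (stmt-QuantumFields-10523):
# vocabulary of the line `orbit-kantorovich-finite-size`

Route-posited objects (D-0016 `<Route><Crux>Defs` file) shared by the registered stubs of the skeleton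
`Cruxes/LatticeGapOnTrajectory/Lines/orbit-kantorovich-finite-size.lean` (lead
`prover-line-stmt-QuantumFields-10523-0`) and by the crux file that composes them. The declarations are
VERBATIM those of the registered skeleton (same namespace, so the registered stub signatures are unchanged);
nothing in this file is asserted: every `def … : Prop` is a statement some stub proves or consumes.

* §1 Cells (pure probability, `G`-blind): `CoarseIdx μ` (discrete 4-torus of cell labels), `cdist`,
  `IsCellLipBound` (multi-site Dobrushin/Föllmer Lipschitz bounds), `windowAvg`, `windowVol`, the
  Kantorovich–Rubinstein window package `IsKRWindow` (Dobrushin–Shlosman finite-size hypotheses in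
  dual-Lipschitz form), the engine statement `KREngine` (proved by `stub_krFiniteSizeDecay`) and the
  window-averaging toolkit statement `SpecificationTower` (`stub_specificationTower`).
* §2 Torus gauge theory read on cells: `IsTorusFrame` (cyclic interval partitions) and `TorusFramesExist`
  (`stub_torusFrames`), `siteCell`, `cellOf`,
  `IsInteriorSite`, `IsInteriorGauge`, `repDist`, `cellDev`, `orbitWeight` (capped gauge-orbit transport
  weight), Wilson's torus specification `torusYM`, the DLR statement `WilsonTorusDLR` (proved by
  `stub_wilsonTorusDLR`), the physics clauses `RoughCentreBound`, `OrbitKRWindowsAlong` (the line's bet,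
  `stub_orbitKantorovichWindow`), and `TransferHalf` (verbatim the crux's last clause).

References: Dobrushin–Shlosman 1985 (constructive criterion), Föllmer 1988 Ch. I §2, Georgii 2011 Def. 1.23 /
§8.2, Osterwalder–Seiler 1978 §2; the line card `Cruxes/LatticeGapOnTrajectory/Lines/orbit-kantorovich-finite-size.md`.
-/

/-!
## Stub `stub_wilsonTorusDLR` (line `orbit-kantorovich-finite-size`): Wilson's torus measure is DLR

`WilsonTorusDLR r`: for every coupling `β` and torus side `N`, Wilson's torus specification
`torusYM r.ρ β N` (product Haar on the links of `Λ` glued with the boundary condition, tilted by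
`-β S_W`) is a specification in Georgii's sense (`isSpecification_torusYM`, the instance `ν = Haar`,
`φ_Λ = -β S_W` of the tree's `isSpecification_tilted_map_glueWith_pi`; `G` is Hausdorff and second
countable through the closed embedding `r.ρ`), and the tree's torus Wilson state `wilsonMeasure r.ρ β`
is its full-volume kernel (`wilsonMeasure_eq_torusYM_univ`, from the tree's `wilsonMeasure_eq_tilted_pi`
and `map_glueWith_univ_pi`), hence a Gibbs measure for it (`IsSpecification.isGibbsMeasure_univ`:
on a finite site set the DLR equations of a full-volume kernel are the consistency axiom).

References: Georgii 2011 Def. 1.23 / Rem. 1.24 / Def. 2.9; Friedli–Velenik 2017 §6.10.1, Lemma 6.15;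
Seiler LNP 159 Ch. 1–2.
-/

namespace Summit.QuantumFields.YangMills.Cruxes.LatticeGapOnTrajectory.OrbitKantorovichFiniteSize
open scoped BigOperators Topology ENNReal ProbabilityTheory
open Filter MeasureTheory
open Literature.Probability.LatticeModels (Specification IsSpecification IsGibbsMeasure glueWith)
open Literature.MathematicalPhysics.QuantumFieldTheory
noncomputable section

/-- **Wilson's torus specification is a specification** (Georgii 2011, Def. 1.23 with Def. 2.9;
Friedli–Velenik 2017, §6.10.1 with Lemma 6.15): for a faithful continuous matrix representation `r`
of the compact group `G` (so that `G` is Hausdorff and second countable through the closed embedding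
`r.ρ`), every coupling `β` and every torus side `N`, the kernels `torusYM r.ρ β N` — product Haar on the
links of `Λ`, glued with the boundary condition, tilted by `-β` times the full torus Wilson action — satisfy
`IsSpecification`. Instance `ν = Haar`, `φ_Λ = -β S_W` (independent of `Λ`, so the relative energies
vanish) of `Literature.Probability.LatticeModels.isSpecification_tilted_map_glueWith_pi`. -/
theorem isSpecification_torusYM {G : Type} [Group G] [TopologicalSpace G] [IsTopologicalGroup G]
    [CompactSpace G] [MeasurableSpace G] [BorelSpace G] (r : LatticeRep G) (β : ℝ) (N : ℕ) [NeZero N] :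
    IsSpecification (torusYM r.ρ β N) := by
  have hemb := (r.continuous.isClosedEmbedding r.injective).isEmbedding
  haveI : T2Space G := hemb.t2Space
  haveI : SecondCountableTopology G := hemb.secondCountableTopology
  have hφm : Measurable fun U : GaugeConfig 4 N G => -β * wilsonAction r.ρ U :=
    (measurable_wilsonAction r.ρ r.continuous).const_mul _
  obtain ⟨B, hB⟩ := exists_abs_wilsonAction_le (d := 4) (L := N) r.ρ r.continuous
  have hφb : ∃ C, ∀ U : GaugeConfig 4 N G, |-β * wilsonAction r.ρ U| ≤ C :=
    ⟨|β| * B, fun U => by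
      rw [abs_mul, abs_neg]
      exact mul_le_mul_of_nonneg_left (hB U) (abs_nonneg β)⟩
  exact Literature.Probability.LatticeModels.isSpecification_tilted_map_glueWith_pi (V := Edge 4 N)
    (haarProbability G) (φ := fun _ U => -β * wilsonAction r.ρ U) (fun _ => hφm) (fun _ => hφb)
    fun _ _ _ U U' _ => by simp only [sub_self]

/-- **The torus Wilson state is the full-volume kernel of Wilson's torus specification**: for every
boundary condition `η` (there is no boundary left), `wilsonMeasure r.ρ β = torusYM r.ρ β N univ η`, i.e.
`Z⁻¹ e^{-β S_W} ∏ₑ dU_e = (Haar^{⊗ links}).tilted (-β S_W)` (Seiler LNP 159 Ch. 1–2; Chatterjee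
arXiv:1803.01950 §2–3; tree `wilsonMeasure_eq_tilted_pi`, `map_glueWith_univ_pi`). -/
theorem wilsonMeasure_eq_torusYM_univ {G : Type} [Group G] [TopologicalSpace G] [IsTopologicalGroup G]
    [CompactSpace G] [MeasurableSpace G] [BorelSpace G] (r : LatticeRep G) (β : ℝ) (N : ℕ) [NeZero N]
    (η : GaugeConfig 4 N G) :
    wilsonMeasure (d := 4) (L := N) r.ρ β = torusYM r.ρ β N Finset.univ η := by
  haveI : SecondCountableTopology G :=
    (r.continuous.isClosedEmbedding r.injective).isEmbedding.secondCountableTopology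
  simp only [torusYM, Literature.MathematicalPhysics.QuantumLattice.map_glueWith_univ_pi]
  exact Literature.MathematicalPhysics.QuantumLattice.wilsonMeasure_eq_tilted_pi r.ρ r.continuous β

/-- **DLR description of the crux's measure** (statement `WilsonTorusDLR`, Georgii 2011 Def. 1.23 /
Rem. 1.24 with Def. 2.9; Seiler LNP 159 Ch. 2): for every faithful continuous unitary matrix
representation `r` of a compact group `G`, every coupling `β` and every torus side `N`, Wilson's torus
specification `torusYM r.ρ β N` is a specification in Georgii's sense and the tree's torus Wilson state
`wilsonMeasure r.ρ β` is a Gibbs measure for it: the Wilson state is the full-volume kernel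
`γ_{univ}(· | η)` (`wilsonMeasure_eq_torusYM_univ`), and on a finite site set the DLR equations for a
full-volume kernel are the consistency axiom (`IsSpecification.isGibbsMeasure_univ`). -/
theorem stub_wilsonTorusDLR :
    ∀ (G : Type) [Group G] [TopologicalSpace G] [IsTopologicalGroup G] [CompactSpace G]
      [MeasurableSpace G] [BorelSpace G] (r : LatticeRep G), WilsonTorusDLR r := by
  intro G _ _ _ _ _ _ r β N _
  refine ⟨isSpecification_torusYM r β N, ?_⟩
  rw [wilsonMeasure_eq_torusYM_univ r β N fun _ => 1]
  exact (isSpecification_torusYM r β N).isGibbsMeasure_univ _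

end

end Summit.QuantumFields.YangMills.Cruxes.LatticeGapOnTrajectory.OrbitKantorovichFiniteSize
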